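import Literature.AlgebraicGeometry.AbelianSchemes.PDivisibleGroupBlockDockingOfLine   -- ★ twin of ED. 7 0ccb3473688f7278 (re-homed, LEAD «M-72»; generic lane, director (R1))
import HarnessLib

/-! # F0_P6d_BlockDocking — ED. 8 = SHIM (re-home). The theorem `blockDocking_of_line` now lives at
`Literature.AlgebraicGeometry.AbelianSchemes.PDivisibleGroupBlockDockingOfLine.blockDocking_of_line`; this file only re-exports it under the old name so the spine՚s
`open …F0P6dBlockDocking (blockDocking_of_line)` and §4 `dockPackage_of_line` stay 0 bytes. -/

set_option linter.dupNamespace false  -- `Summit.HodgeConjecture.HodgeConjecture.…` BY DESIGN (D-0017)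
namespace Summit.HodgeConjecture.HodgeConjecture.Cruxes.HLiu418.F0P6dBlockDocking
export Literature.AlgebraicGeometry.AbelianSchemes.PDivisibleGroupBlockDockingOfLine (blockDocking_of_line)
end Summit.HodgeConjecture.HodgeConjecture.Cruxes.HLiu418.F0P6dBlockDocking
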